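import Mathlib
import Literature.MathematicalPhysics.QuantumFieldTheory.BalabanImbrieJaffe1984to88.BIJ85Eq712SymbolCalculus

/-!
# `BalabanImbrieJaffe1984to88.BIJ85Eq7122Loewner` — T. Bałaban, J. Imbrie, A. Jaffe, *Renormalization of the Higgs model:
minimizers, propagators and the stability of mean field theory*, Commun. Math. Phys. **97** (1985) 299–329
[BalabanImbrieJaffe1985]: Sect. 7.1 pp. 321, 324 — **(7.1.1) `c ≤ σ_k` and (7.1.22) `c ≤ σ_k(p)` read AS OPERATOR
INEQUALITIES** (Loewner order): for every translation-invariant operator on multi-component fields over the unit torus,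
`c ≤ T ⟺ c ≤ σ_T(p) for all p`, together with the transfer of symmetry, positivity and the operator norm ((7.1.24)
`‖τ₂‖ ≤ M`) between an operator and its momentum representation, and the equivalence of the operator reading of (7.1.1)
with the quadratic-form reading `c‖f‖² ≤ ⟨f, σ_k f⟩` used on p. 324 — file 5 of the (7.1.2) cluster
(`BIJ85Eq712Plancherel`, `BIJ85Eq712SymbolCalculus`, `BIJ85Eq712SymbolInverse`, `BIJ85Eq715ConfigSymbols`)

statement-level skeleton of published theorems with citation tags; proofs where landed; nothing here is a claim about
the Yang–Mills mass gap

PDF held: `paper:balaban1985-cmp97-bij-higgs-minimizers` (journal page = PDF page + 298).  Text read: PDF pp. 23, 26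
(journal 321, 324).

CITATION HEADER (lean-in-tree rule).  Part of the lit-balaban TYPED SKELETON (HOME `run/shared/lean/pub/lit-balaban/`); WHAT IS
REPRODUCED: supporting algebra for SKELETON rows **C1.Thm7.1.1** and **C1.Prop7.1.2** of `HOME/lit-balaban-r15/ROWS-C1.md` (owner
r15, referee ref-5).  THE PRINTED TEXT, verbatim: p. 321 [PDF 23] *"Theorem 7.1.1. There exists a constant c > 0, independent
of k, such that c ≤ σ_k. (7.1.1) … Since we study periodic boundary conditions, σ_k is translation invariant. Thus it is natural
to study σ_k as a multiplication operator σ_k(p) in the Fourier transform representation."*; p. 324 [PDF 26] *"Proof. It is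
sufficient to show that there is a constant c > 0 such that c ≤ σ_k(p) (7.1.22) for all |p_j| ≤ π. The inequality … (7.1.23) is
an extension of (7.1.20). As a consequence, ‖τ₂‖ ≤ M, (7.1.24) where M is a constant independent of p and k."*
TYPED READING: as in `BIJ85Eq712Plancherel` — unit torus `Tor N` of `Balaban1983to89.B5Prop11Plancherel`, fields
`Tor N × m → ℂ`, `F⊗1 = dftC` (unitary), `IsTranslInv`, symbol `symb T p : Matrix m m ℂ`, fibre operator `fibreOp`; the
inequality `c ≤ A` between a real constant and a (finite) Hermitian operator is Mathlib's `(A − c•1).PosSemidef` over `ℂ` with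
its star order (`open scoped ComplexOrder`); `‖·‖` is the `ℓ² → ℓ²` operator norm (`Matrix.instL2OpNormedRing`).
WHAT IS KERNEL-CHECKED (zero `sorry`, standard axioms): §1 `reindex_fibreOp` (`⊕_p B(p)` is Mathlib's `blockDiagonal B`
re-indexed), `fibreOp_conjTranspose`, `isHermitian_fibreOp_iff`, `star_dotProduct_fibreOp_mulVec`, `posSemidef_fibreOp_iff`,
`posDef_fibreOp_iff`; §2 for translation-invariant `T`: `isHermitian_iff_fibrewise`, **`posSemidef_iff_fibrewise`**,
`posDef_iff_fibrewise`; §3 **(7.1.1) ⟺ (7.1.22)** `symb_sub_smul_one`, **`loewner_iff_fibrewise`**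
(`c ≤ T ⟺ ∀ p, c ≤ σ_T(p)`); §4 the operator reading versus the form reading: `posSemidef_sub_smul_one_iff`
(`c ≤ A ⟺ A Hermitian ∧ ∀ v, c‖v‖² ≤ Re⟨v, Av⟩`), `thm711_of_loewner` / `loewner_of_thm711` / `thm711_of_fibrewise_loewner` on
r15's carrier (`BIJ85Eq712Plancherel.sigmaFormOf`, `BIJ85Sect7Statements.Thm711`); §5 (7.1.24)-type norm transfer
`opNorm_eq_opNorm_blockDiagonal`, `opNorm_symb_le`, **`opNorm_le_iff_fibrewise`** (`‖T‖ ≤ C ⟺ ∀ p, ‖σ_T(p)‖ ≤ C`).  NOT CLAIMED: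
any bound for the concrete σ_k, τ₂ of (7.1.12)–(7.1.15) (those are `BIJ85Thm711Fibrewise` / `BIJ85Prop712Fibre`, seat p10).
Unit `lit-balaban-p27` (gen 4).
-/

namespace Literature.MathematicalPhysics.QuantumFieldTheory.BalabanImbrieJaffe1984to88.BIJ85Eq7122Loewner

open scoped BigOperators Matrix ComplexConjugate ComplexOrder Matrix.Norms.L2Operator
open Finset Complex
open Literature.MathematicalPhysics.QuantumFieldTheory.Balaban1983to89.B5Prop11Plancherel
open Literature.MathematicalPhysics.QuantumFieldTheory.BalabanImbrieJaffe1984to88.BIJ85Sect7Statements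
open Literature.MathematicalPhysics.QuantumFieldTheory.BalabanImbrieJaffe1984to88.BIJ85Eq712Plancherel
open Literature.MathematicalPhysics.QuantumFieldTheory.BalabanImbrieJaffe1984to88.BIJ85Eq712SymbolCalculus

noncomputable section

/-! ## §1 Fibre operators `⊕_p B(p)`: symmetry and positivity fibre by fibre -/

section Torus

variable {d : ℕ} (N : Fin d → ℕ) [hN : ∀ μ, NeZero (N μ)] (m : Type*) [Fintype m] [DecidableEq m]

omit hN [Fintype m] [DecidableEq m] in
/-- `⊕_p B(p)` is Mathlib's block-diagonal matrix of the family `B`, with the index pair swapped.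
[cite: BalabanImbrieJaffe1985, (7.1.2) p.321] -/
theorem reindex_fibreOp (B : Tor N → Matrix m m ℂ) :
    Matrix.reindex (Equiv.prodComm (Tor N) m) (Equiv.prodComm (Tor N) m) (fibreOp N m B) = Matrix.blockDiagonal B := by
  ext ⟨i, p⟩ ⟨j, q⟩
  rw [Matrix.reindex_apply, Matrix.submatrix_apply, Equiv.prodComm_symm, Equiv.prodComm_apply, Equiv.prodComm_apply,
    Prod.swap_prod_mk, Prod.swap_prod_mk, fibreOp_apply, Matrix.blockDiagonal_apply]

omit hN [Fintype m] [DecidableEq m] in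
/-- `(⊕_p B(p))^* = ⊕_p B(p)^*`. [cite: BalabanImbrieJaffe1985, (7.1.2) p.321] -/
theorem fibreOp_conjTranspose (B : Tor N → Matrix m m ℂ) :
    (fibreOp N m B)ᴴ = fibreOp N m (fun p => (B p)ᴴ) := by
  ext ⟨p, i⟩ ⟨q, j⟩
  rw [Matrix.conjTranspose_apply, fibreOp_apply, fibreOp_apply, Matrix.conjTranspose_apply]
  by_cases h : p = q
  · subst h
    rw [if_pos rfl, if_pos rfl]
  · rw [if_neg h, if_neg (Ne.symm h), star_zero]

omit hN [Fintype m] [DecidableEq m] in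
/-- the fibre `B(p)` is the `(p,p)` block of `⊕_q B(q)`. [folklore] -/
private theorem submatrix_fibreOp (B : Tor N → Matrix m m ℂ) (p : Tor N) :
    (fibreOp N m B).submatrix (Prod.mk p) (Prod.mk p) = B p := by
  ext i j
  rw [Matrix.submatrix_apply, fibreOp_apply, if_pos rfl]

omit hN [Fintype m] [DecidableEq m] in
/-- `⊕_p B(p)` is symmetric iff every fibre is ("σ_k … σ_k(p)" for the symmetric σ_k, p. 321).
[cite: BalabanImbrieJaffe1985, (7.1.2) p.321] -/
theorem isHermitian_fibreOp_iff (B : Tor N → Matrix m m ℂ) :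
    (fibreOp N m B).IsHermitian ↔ ∀ p, (B p).IsHermitian := by
  constructor
  · intro h p
    rw [← submatrix_fibreOp N m B p]
    exact h.submatrix _
  · intro h
    unfold Matrix.IsHermitian
    rw [fibreOp_conjTranspose]
    congr 1
    funext p
    exact (h p).eq

omit [DecidableEq m] in
/-- the fibre operator acts fibre by fibre: `((⊕_q B(q)) g)(p, ·) = B(p) g(p, ·)`. [cite: BalabanImbrieJaffe1985, (7.1.2) p.321] -/
theorem fibreOp_mulVec_apply (B : Tor N → Matrix m m ℂ) (g : Tor N × m → ℂ) (p : Tor N) (i : m) :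
    (fibreOp N m B *ᵥ g) (p, i) = (B p *ᵥ fun j => g (p, j)) i := by
  simp only [Matrix.mulVec, dotProduct]
  rw [Fintype.sum_prod_type, Finset.sum_eq_single p]
  · simp [fibreOp_apply]
  · intro q _ hq
    simp only [fibreOp_apply, if_neg (Ne.symm hq), zero_mul, Finset.sum_const_zero]
  · exact fun h => absurd (Finset.mem_univ p) h

omit [DecidableEq m] in
/-- the quadratic form of `⊕_p B(p)` is the sum of the fibre forms (the right member of (7.1.2)).
[cite: BalabanImbrieJaffe1985, (7.1.2) p.321] -/
theorem star_dotProduct_fibreOp_mulVec (B : Tor N → Matrix m m ℂ) (g : Tor N × m → ℂ) :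
    star g ⬝ᵥ (fibreOp N m B *ᵥ g) = ∑ p : Tor N, star (fun i => g (p, i)) ⬝ᵥ (B p *ᵥ fun i => g (p, i)) := by
  rw [dotProduct, Fintype.sum_prod_type]
  refine Finset.sum_congr rfl fun p _ => ?_
  rw [dotProduct]
  exact Finset.sum_congr rfl fun i _ => by rw [fibreOp_mulVec_apply]; rfl

omit [DecidableEq m] in
/-- **`0 ≤ ⊕_p B(p) ⟺ 0 ≤ B(p)` for every `p`**. [cite: BalabanImbrieJaffe1985, (7.1.22) p.324] -/
theorem posSemidef_fibreOp_iff (B : Tor N → Matrix m m ℂ) :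
    (fibreOp N m B).PosSemidef ↔ ∀ p, (B p).PosSemidef := by
  constructor
  · intro h p
    rw [← submatrix_fibreOp N m B p]
    exact h.submatrix _
  · intro h
    refine Matrix.PosSemidef.of_dotProduct_mulVec_nonneg
      ((isHermitian_fibreOp_iff N m B).2 fun p => (h p).isHermitian) fun g => ?_
    rw [star_dotProduct_fibreOp_mulVec]
    exact Finset.sum_nonneg fun p _ => (h p).dotProduct_mulVec_nonneg _

omit [DecidableEq m] in
/-- `0 < ⊕_p B(p) ⟺ 0 < B(p)` for every `p` (strict positivity). [cite: BalabanImbrieJaffe1985, (7.1.22) p.324] -/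
theorem posDef_fibreOp_iff (B : Tor N → Matrix m m ℂ) :
    (fibreOp N m B).PosDef ↔ ∀ p, (B p).PosDef := by
  constructor
  · intro h p
    rw [← submatrix_fibreOp N m B p]
    exact h.submatrix (Prod.mk_right_injective p)
  · intro h
    refine Matrix.PosDef.of_dotProduct_mulVec_pos
      ((isHermitian_fibreOp_iff N m B).2 fun p => (h p).isHermitian) fun g hg => ?_
    rw [star_dotProduct_fibreOp_mulVec]
    obtain ⟨p₀, hp₀⟩ : ∃ p, (fun i => g (p, i)) ≠ 0 := by
      by_contra hall
      push Not at hall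
      exact hg (funext fun a => by simpa using congrFun (hall a.1) a.2)
    exact Finset.sum_pos' (fun p _ => (h p).posSemidef.dotProduct_mulVec_nonneg _)
      ⟨p₀, Finset.mem_univ _, (h p₀).dotProduct_mulVec_pos hp₀⟩

/-! ## §2 Translation-invariant operators: symmetry and positivity are read off the symbol -/

/-- `F⊗1` is invertible (it is unitary). [folklore] -/
private theorem isUnit_dftC : IsUnit (dftC N m) :=
  ⟨⟨dftC N m, star (dftC N m), dftC_mul_star N m, star_dftC_mul N m⟩, rfl⟩

/-- `T` is symmetric iff every symbol `σ_T(p)` is Hermitian (*"σ_k … as a multiplication operator σ_k(p)"*; the forward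
direction is `BIJ85Eq712Plancherel.symb_isHermitian`). [cite: BalabanImbrieJaffe1985, (7.1.2) p.321] -/
theorem isHermitian_iff_fibrewise {T : Matrix (Tor N × m) (Tor N × m) ℂ} (hT : IsTranslInv N m T) :
    T.IsHermitian ↔ ∀ p, (symb N m T p).IsHermitian := by
  refine ⟨fun h p => symb_isHermitian N m hT h p, fun h => ?_⟩
  have hF : (fibreOp N m (symb N m T)).IsHermitian := (isHermitian_fibreOp_iff N m _).2 h
  rw [eq_star_dftC_mul_fibreOp_mul_dftC N m hT, Matrix.star_eq_conjTranspose]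
  exact Matrix.isHermitian_conjTranspose_mul_mul _ hF

/-- **`0 ≤ T ⟺ 0 ≤ σ_T(p)` for every dual momentum `p`** (unitary conjugation by `F⊗1` and §1).
[cite: BalabanImbrieJaffe1985, (7.1.22) p.324] -/
theorem posSemidef_iff_fibrewise {T : Matrix (Tor N × m) (Tor N × m) ℂ} (hT : IsTranslInv N m T) :
    T.PosSemidef ↔ ∀ p, (symb N m T p).PosSemidef := by
  have h := eq_star_dftC_mul_fibreOp_mul_dftC N m hT
  calc T.PosSemidef ↔ (star (dftC N m) * fibreOp N m (symb N m T) * dftC N m).PosSemidef := by rw [← h]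
    _ ↔ (fibreOp N m (symb N m T)).PosSemidef := Matrix.IsUnit.posSemidef_star_left_conjugate_iff (isUnit_dftC N m)
    _ ↔ ∀ p, (symb N m T p).PosSemidef := posSemidef_fibreOp_iff N m _

/-- `0 < T ⟺ 0 < σ_T(p)` for every dual momentum `p`. [cite: BalabanImbrieJaffe1985, (7.1.22) p.324] -/
theorem posDef_iff_fibrewise {T : Matrix (Tor N × m) (Tor N × m) ℂ} (hT : IsTranslInv N m T) :
    T.PosDef ↔ ∀ p, (symb N m T p).PosDef := by
  have h := eq_star_dftC_mul_fibreOp_mul_dftC N m hT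
  calc T.PosDef ↔ (star (dftC N m) * fibreOp N m (symb N m T) * dftC N m).PosDef := by rw [← h]
    _ ↔ (fibreOp N m (symb N m T)).PosDef := Matrix.IsUnit.posDef_star_left_conjugate_iff (isUnit_dftC N m)
    _ ↔ ∀ p, (symb N m T p).PosDef := posDef_fibreOp_iff N m _

/-! ## §3 (7.1.1) ⟺ (7.1.22): `c ≤ T ⟺ c ≤ σ_T(p)` for all `p` -/

omit hN [Fintype m] in
/-- `T − c` is translation invariant with `T`. [cite: BalabanImbrieJaffe1985, (7.1.22) p.324] -/
theorem IsTranslInv.sub_smul_one {T : Matrix (Tor N × m) (Tor N × m) ℂ} (hT : IsTranslInv N m T) (c : ℂ) :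
    IsTranslInv N m (T - c • 1) :=
  (isTranslInvR_iff N m _).1 (((isTranslInvR_iff N m T).2 hT).sub ((isTranslInvR_one N m).smul c))

omit [Fintype m] in
/-- the symbol of `T − c` is `σ_T(p) − c`. [cite: BalabanImbrieJaffe1985, (7.1.22) p.324] -/
theorem symb_sub_smul_one (T : Matrix (Tor N × m) (Tor N × m) ℂ) (c : ℂ) (p : Tor N) :
    symb N m (T - c • 1) p = symb N m T p - c • 1 := by
  rw [← symbR_eq_symb, ← symbR_eq_symb, symbR_sub, symbR_smul, symbR_one]

/-- **(7.1.1) ⟺ (7.1.22)**, operator reading: for a translation-invariant `T` on the unit torus and a real constant `c`,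
`c ≤ T` (i.e. `T − c ≥ 0`) iff `c ≤ σ_T(p)` for EVERY dual momentum `p` — *"It is sufficient to show that there is a constant
c > 0 such that c ≤ σ_k(p) (7.1.22) for all |p_j| ≤ π"*, and conversely. [cite: BalabanImbrieJaffe1985, (7.1.22) p.324] -/
theorem loewner_iff_fibrewise {T : Matrix (Tor N × m) (Tor N × m) ℂ} (hT : IsTranslInv N m T) (c : ℝ) :
    (T - (c : ℂ) • 1).PosSemidef ↔ ∀ p, (symb N m T p - (c : ℂ) • 1).PosSemidef := by
  rw [posSemidef_iff_fibrewise N m (IsTranslInv.sub_smul_one N m hT (c : ℂ))]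
  simp_rw [symb_sub_smul_one]

end Torus

/-! ## §4 The operator reading `c ≤ A` versus the form reading `c‖v‖² ≤ Re⟨v, Av⟩` -/

section Form

variable {ι : Type*} [Fintype ι] [DecidableEq ι]

omit [DecidableEq ι] in
/-- kernel: `⟨v, v⟩ = Σ_i |v_i|²`. [folklore] -/
private theorem star_dotProduct_self (v : ι → ℂ) : star v ⬝ᵥ v = ((∑ i, ‖v i‖ ^ 2 : ℝ) : ℂ) := by
  rw [dotProduct, Complex.ofReal_sum]
  refine Finset.sum_congr rfl fun i _ => ?_
  rw [Pi.star_apply, Complex.star_def, Complex.conj_mul', Complex.ofReal_pow]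

omit [Fintype ι] in
/-- `c•1` is Hermitian for real `c`. [folklore] -/
private theorem isHermitian_smul_one (c : ℝ) : ((c : ℂ) • (1 : Matrix ι ι ℂ)).IsHermitian := by
  unfold Matrix.IsHermitian
  rw [Matrix.conjTranspose_smul, Matrix.conjTranspose_one, Complex.star_def, Complex.conj_ofReal]

/-- For a finite matrix `A` over `ℂ` and a real constant `c`: `c ≤ A` in the operator (Loewner) sense iff `A` is Hermitian and
`c‖v‖² ≤ Re⟨v, Av⟩` for every `v` — the operator statement (7.1.1)/(7.1.22) and the quadratic-form statement the proof on
p. 324 establishes (`⟨f, σ_k f⟩ ≥ c‖f‖²`) are the same. [cite: BalabanImbrieJaffe1985, (7.1.22) p.324] -/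
theorem posSemidef_sub_smul_one_iff (A : Matrix ι ι ℂ) (c : ℝ) :
    (A - (c : ℂ) • 1).PosSemidef ↔ A.IsHermitian ∧ ∀ v : ι → ℂ, c * ∑ i, ‖v i‖ ^ 2 ≤ (star v ⬝ᵥ (A *ᵥ v)).re := by
  have hform : ∀ v : ι → ℂ, star v ⬝ᵥ ((A - (c : ℂ) • 1) *ᵥ v)
      = star v ⬝ᵥ (A *ᵥ v) - ((c * ∑ i, ‖v i‖ ^ 2 : ℝ) : ℂ) := by
    intro v
    rw [Matrix.sub_mulVec, dotProduct_sub, Matrix.smul_mulVec, Matrix.one_mulVec, dotProduct_smul, smul_eq_mul,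
      star_dotProduct_self, Complex.ofReal_mul]
  constructor
  · intro h
    have hA : A.IsHermitian := by
      have h1 : A = (A - (c : ℂ) • 1) + (c : ℂ) • 1 := (sub_add_cancel A _).symm
      rw [h1]
      exact h.isHermitian.add (isHermitian_smul_one c)
    refine ⟨hA, fun v => ?_⟩
    have h2 := h.dotProduct_mulVec_nonneg v
    rw [hform, Complex.le_def] at h2
    have h3 := h2.1
    rw [Complex.zero_re, Complex.sub_re, Complex.ofReal_re] at h3
    linarith
  · rintro ⟨hA, hv⟩
    refine Matrix.PosSemidef.of_dotProduct_mulVec_nonneg (hA.sub (isHermitian_smul_one c)) fun v => ?_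
    have him : (star v ⬝ᵥ (A *ᵥ v)).im = 0 := by
      have h : star (star v ⬝ᵥ (A *ᵥ v)) = star v ⬝ᵥ (A *ᵥ v) := by
        conv_lhs => rw [Matrix.star_dotProduct, star_star, Matrix.star_mulVec, ← Matrix.dotProduct_mulVec, hA.eq]
      exact Complex.conj_eq_iff_im.1 h
    rw [hform, Complex.le_def, Complex.zero_re, Complex.zero_im, Complex.sub_re, Complex.sub_im, Complex.ofReal_re,
      Complex.ofReal_im, him, sub_zero]
    exact ⟨by linarith [hv v], rfl⟩

end Form

/-! ## §4b Theorem 7.1.1 in the operator reading, on r15's carrier -/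

section Family

variable {d : ℕ} (N : ℕ → Fin d → ℕ) [hN : ∀ k μ, NeZero (N k μ)] (m : Type) [Fintype m] [DecidableEq m]
  (T : (k : ℕ) → Matrix (Tor (N k) × m) (Tor (N k) × m) ℂ)

/-- **Theorem 7.1.1, operator reading ⇒ r15's `Thm711`**: if one `c > 0` satisfies `c ≤ T_k` (Loewner) for every k, then
`Thm711 (sigmaFormOf N m T)` (`∃ c > 0 ∀ k f, c‖f‖² ≤ ⟨f, σ_k f⟩`). No translation invariance is needed for this direction.
[cite: BalabanImbrieJaffe1985, Thm. 7.1.1 p.321] -/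
theorem thm711_of_loewner {c : ℝ} (hc : 0 < c) (h : ∀ k, (T k - (c : ℂ) • 1).PosSemidef) :
    Thm711 (sigmaFormOf N m T) :=
  ⟨c, hc, fun k f => ((posSemidef_sub_smul_one_iff (T k) c).1 (h k)).2 f⟩

/-- … and conversely for symmetric `T_k`: `Thm711` gives one `c > 0` with `c ≤ T_k` for every k.
[cite: BalabanImbrieJaffe1985, Thm. 7.1.1 p.321] -/
theorem loewner_of_thm711 (hH : ∀ k, (T k).IsHermitian) (h : Thm711 (sigmaFormOf N m T)) :
    ∃ c : ℝ, 0 < c ∧ ∀ k, (T k - (c : ℂ) • 1).PosSemidef := by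
  obtain ⟨c, hc, hall⟩ := h
  exact ⟨c, hc, fun k => (posSemidef_sub_smul_one_iff (T k) c).2 ⟨hH k, hall k⟩⟩

/-- **Theorem 7.1.1 from (7.1.22) in the operator reading**: translation-invariant `T_k` with `c ≤ σ_{T_k}(p)` (Loewner) for
one `c > 0`, all k and all dual momenta p ⇒ `Thm711 (sigmaFormOf N m T)`. [cite: BalabanImbrieJaffe1985, Prop. 7.1.2 (7.1.22) p.324] -/
theorem thm711_of_fibrewise_loewner (hT : ∀ k, IsTranslInv (N k) m (T k)) {c : ℝ} (hc : 0 < c)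
    (hfib : ∀ (k : ℕ) (p : Tor (N k)), (symb (N k) m (T k) p - (c : ℂ) • 1).PosSemidef) :
    Thm711 (sigmaFormOf N m T) :=
  thm711_of_loewner N m T hc fun k => (loewner_iff_fibrewise (N k) m (hT k) c).2 (hfib k)

end Family

/-! ## §5 (7.1.24)-type statements: the operator norm is the largest fibre norm -/

section OpNorm

variable {d : ℕ} (N : Fin d → ℕ) [hN : ∀ μ, NeZero (N μ)] (m : Type*) [Fintype m] [DecidableEq m]

/-- `‖T‖ = ‖⊕_p σ_T(p)‖` (`F⊗1` unitary, re-indexing isometric). [cite: BalabanImbrieJaffe1985, (7.1.24) p.324] -/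
theorem opNorm_eq_opNorm_blockDiagonal {T : Matrix (Tor N × m) (Tor N × m) ℂ} (hT : IsTranslInv N m T) :
    ‖T‖ = ‖Matrix.blockDiagonal (symb N m T)‖ := by
  rw [← reindex_fibreOp N m, opNorm_reindex, ← dftC_conj_eq_fibreOp N m hT,
    opNorm_unitary_conj (dftC_mem_unitaryGroup N m)]

/-- every fibre norm is bounded by the operator norm: `‖σ_T(p)‖ ≤ ‖T‖`. [cite: BalabanImbrieJaffe1985, (7.1.24) p.324] -/
theorem opNorm_symb_le {T : Matrix (Tor N × m) (Tor N × m) ℂ} (hT : IsTranslInv N m T) (p : Tor N) :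
    ‖symb N m T p‖ ≤ ‖T‖ := by
  rw [opNorm_eq_opNorm_blockDiagonal N m hT]
  exact opNorm_le_opNorm_blockDiagonal _ p

/-- **`‖T‖ ≤ C ⟺ ‖σ_T(p)‖ ≤ C` for every dual momentum `p`** — a bound *"where M is a constant independent of p"* on the
symbol ((7.1.24) `‖τ₂‖ ≤ M`) is the same as the bound on the configuration-space operator.
[cite: BalabanImbrieJaffe1985, (7.1.24) p.324] -/
theorem opNorm_le_iff_fibrewise {T : Matrix (Tor N × m) (Tor N × m) ℂ} (hT : IsTranslInv N m T) {C : ℝ} (hC : 0 ≤ C) :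
    ‖T‖ ≤ C ↔ ∀ p, ‖symb N m T p‖ ≤ C := by
  refine ⟨fun h p => (opNorm_symb_le N m hT p).trans h, fun h => ?_⟩
  rw [opNorm_eq_opNorm_blockDiagonal N m hT]
  exact opNorm_blockDiagonal_le _ hC h

end OpNorm

end

end Literature.MathematicalPhysics.QuantumFieldTheory.BalabanImbrieJaffe1984to88.BIJ85Eq7122Loewner
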